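import Literature.MathematicalPhysics.QuantumFieldTheory.Balaban1983to89.HiggsCondCov232
import Literature.MathematicalPhysics.QuantumFieldTheory.Balaban1983to89.B2Eq228Conditioning

/-!
# `Balaban1983to89.HiggsCondGauss228` — T. Bałaban, *(Higgs)₂,₃ quantum fields in a finite volume. I. A lower bound*,
Commun. Math. Phys. **85** (1982) 603–626 [Balaban1982Higgs1] p. 611 (2.32) and *II. An upper bound*, Commun. Math.
Phys. **86** (1982) 555–594 [Balaban1982Higgs2] p. 563 (2.28): the Gaussian probability measure `dμ_{C^{(k)}_Λ(Ω,A)}` with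
the conditional covariance (2.32) of the CONCRETE scalar field — the measure of the *"conditional integration with
conditioning on Λ₅ᶜ"* of II (2.28)/(2.46) — realised as p15's `B2Eq228Conditioning.gaussProb` of the block `A_Λ` of the
concrete quadratic form `½⟨φ′, (a(L^{k+1}ε)^{−2}P(A) + Δ^{(k),L^kε}(Ω,A))φ′⟩` in p34's integration coordinates; PROVED:
the coordinate matrix is symmetric positive definite (so II (2.28) `display228` APPLIES to the model), the measure is a
probability measure, its covariance matrix IS the coordinate block of `C^{(k)}_Λ(Ω,A)` (file 2 `HiggsCondCov232.condCov232`),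
and the moment generating function `∫ e^{⟨g,φ′⟩} dμ_{C^{(k)}_Λ(Ω,A)}(φ′) = e^{½⟨g, C^{(k)}_Λ(Ω,A)g⟩}` for (1.5)

statement-level skeleton of published theorems with citation tags; proofs where landed; nothing here is a claim about the Yang–Mills mass gap

PDFs held: `paper:balaban1982-cmp85-higgs23-i` (journal page = PDF page + 602), p. 611 [PDF 9]; `paper:balaban1982-cmp86-higgs23-ii`
(journal page = PDF page + 554), pp. 563, 567 [PDF 9, 13] — read AS IMAGES on the ×2 renders under
`run/shared/lean/pub/pub-balaban/b2b-balaban-ref1/pages/1982-cmp85-higgs23-I/…-p009-x2.png`, `…/1982-cmp86-higgs23-II/…-p009, -p013-x2.png`.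

CITATION HEADER (lean-in-tree rule).  lit-balaban typed skeleton (HOME `run/shared/lean/pub/lit-balaban/`), typer line
(concrete carriers), gen 5; file 3 of the (2.32) line (file 1 `B1Eq230FluctCovPos`: the operator of (2.30) is symmetric
positive definite for general `A`; file 2 `HiggsCondCov232`: `C^{(k)}_Λ(Ω,A)` (2.32) concretely).  SKELETON rows served:
**B1.Eq2.30** (member (2.32), owners r01/r14), **B2.Eq2.28** (the model instance of p15's `display228` for the concrete
scalar quadratic form; owner r02) and the typer cells of **B2.Eq2.44** ((2.45)/(2.46), ROWS-B2 v2.21).  NOTHING of record is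
restated: the (2.28) apparatus (`In/Out/resIn/resOut/glue/blkIn`, `gaussProb`, `model`, `display228_of_bounded`) IS p15's
`B2Eq228Conditioning`, the coordinates ARE p34's `B1Eq221Coordinates.fieldCoord` and p35's `B1Eq230FluctCov.mat`, the
operators ARE p35's `precOpA` and the typer's `condCov232`/`cutTo`.
THE SOURCE TEXT, verbatim.  I p. 611: *"C^{(k)}_Λ(Ω, A) = ((aL^{−2}P(A) + Δ^{(k)}(Ω, A))↾_Λ)^{−1}. (2.32)"*.  II p. 563:
*"it will be a conditional integration with conditioning on Λ₅ᶜ. Let us recall this operation in a general case. Let Ω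
be a finite set, Λ ⊂ Ω, and let A be a positive operator on a space of field configurations on Ω, A_Λ its restriction on
Λ. Then we have ∫Π_{x∈Ω}dφ(x) exp(−½⟨φ,Aφ⟩) exp(⟨f,φ⟩) F(φ↾_Λ) G(φ↾_{Λᶜ}) = ∫Π_{x∈Ω}dφ(x) exp(−½⟨φ,Aφ⟩) exp(⟨f,φ⟩)
G(φ↾_{Λᶜ}) · ∫dμ_{A_Λ⁻¹}(φ′) F(φ′ − A_Λ⁻¹Aφ↾_{Λᶜ} + A_Λ⁻¹f), (2.28) where dμ_{A_Λ⁻¹} is a probabilistic Gaussian measure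
with the covariance A_Λ⁻¹. In our case A is given by the main quadratic form in the fields A′, φ′"*; II p. 567: *"Another
representation is obtained by calculation of a conditional integral in (2.45) with the conditioning on Λ₅^{(k−1)c}"*
((2.46), with `C^{(k−1),L^{k−1}ε}_{Λ₅^{(k−1)}}(B^{k−1}(Λ₂^{(k−1)}), A^{(k),ε})`).

WHAT THIS FILE PROVES (0 sorry; standard axioms; definitions with bodies + theorems).
§1 THE LETTERS OF (2.28) FOR THE CONCRETE SCALAR FIELD at level `k`: `Ω ↦ S := T^{(k)} × (internal index)` (p34's
   coordinates), `Λ ↦ inSet Λ` (the predicate `x ∈ Λ` on `S`), the cut `Λφ` in coordinates = p15's `glue (φ↾_Λ) 0`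
   (`fieldCoord_cutTo`, `fieldCoord_cutTo_compl`), `fieldOfCrd Λ x` = the configuration `φ′ : Λ → R^N` extended by zero;
   `A ↦ formMat C Ω A msq a k := (L^kε)^d · mat(a(L^{k+1}ε)^{−2}P(A) + Δ^{(k)}(Ω,A))` with `u·(formMat)v = ⟨φ, (…)ψ⟩_{(1.5)}`
   (`dotProduct_formMat_mulVec`), `e^{−½u·(formMat)u}` = the scalar Gaussian density of II (2.45) (`weight_formMat`), and
   p15's `gaussInt` over `S → ℝ` = the field integral `∫dφ′` (`integral_weight_eq_field`, p34's change of variables).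
§2 **`formMat` is SYMMETRIC and POSITIVE DEFINITE** (`formMat_isSymm`, `formMat_posDef`; m² > 0, a > 0, L > 1, k ≤ K; every
   `A`, `Ω`, `C`) — from file 1 — hence **II (2.28) HOLDS FOR THE MODEL**: `display228_model` (= p15's
   `display228_of_bounded` with its `hA` discharged; bounded measurable `F`, `G`, any source `f`, any `Λ`).
§3 **`dμ_{C^{(k)}_Λ(Ω,A)}`** := `condGauss C Ω A msq a k Λ = gaussProb (blkIn Λ formMat)` — a PROBABILITY measure
   (`isProbabilityMeasure_condGauss`); the block dictionary `blkIn (mat M)·x = (M(glue x 0))↾_Λ`, `blkIn (mat M↾_Λ) =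
   blkIn (mat M)`, and **`(blkIn Λ formMat)⁻¹ = (L^kε)^{−d} · blkIn Λ (mat C^{(k)}_Λ(Ω,A))`** (`inv_blkIn_formMat`: the
   covariance matrix `A_Λ⁻¹` of the print IS the coordinate block of (2.32)).
§4 **THE COVARIANCE IDENTITY**: `∫ e^{⟨g, φ′⟩} dμ_{C^{(k)}_Λ(Ω,A)}(φ′) = e^{½⟨g, C^{(k)}_Λ(Ω,A)g⟩}` for the scalar product (1.5)
   and every field `g` (`integral_exp_siteInner_condGauss`; via p15's linear shift `integral_tilt`) — `dμ` IS the centred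
   Gaussian measure with covariance `C^{(k)}_Λ(Ω,A)`.
HONEST SCOPE.  (a) `Λ` any finite set of sites of `T^{(k)}` (paper: unions of big blocks); (b) operators on all of `T^{(k)}`
resp. `T_ε` as in files 1–2 (m² > 0); (c) only the SCALAR-field factor of *"the main quadratic form in the fields A′, φ′"* is
instantiated here (the vector-field factor at `A = 0`, `N = d` is the typer's `HiggsFluctMeasure*` line); (d) nothing
quantitative ((2.34), II (2.31)).  Value = the concrete objects II (2.45)/(2.46)/(2.53) and III (1.16) integrate against,
with p15's (2.28) available BY NAME for them; NOT summit progress.  Unit `lit-balaban-typer` gen 5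
(literature-prover-lit-balaban-typer-g5-0); HOME/FILED.md records the proposal.
-/

open scoped BigOperators InnerProductSpace Matrix
open _root_.MeasureTheory Matrix

namespace Literature.MathematicalPhysics.QuantumFieldTheory.Balaban1983to89.HiggsCondGauss228

open HiggsLattice HiggsCovariance B1Eq221Coordinates B1Eq230FluctCov B1Eq230FluctCovPos HiggsCondCov232 B2Eq255Concrete
open HiggsCovariancePos (siteInner_self_nonneg eq_zero_of_siteInner_self_eq_zero)
open HiggsFluctMeasurePos (siteInner_comm siteInner_add_right siteInner_sub_right siteInner_smul_right siteInner_smul_left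
  siteInner_self_pos)
open HiggsFluctMeasureCov (siteInner_zero_right)
open B2Eq228Conditioning (In Out resIn resOut glue blkIn blkMix gaussProb weight source model)
open B13GaugeDevices (gaussWeight gaussInt gaussNorm)

variable {P : HiggsLattice.Params} {N : ℕ}

/-! ## §1 The letters of II (2.28) for the concrete scalar field at level `k` -/

section Letters

variable {k : ℕ}

/-- `Λ ⊂ Ω` of II (2.28) as a predicate on the coordinate index set `S = T^{(k)} × (internal index)` of p34's
`fieldCoord`: the coordinate `(x, i)` belongs to `Λ` iff the site `x` does. [cite: Balaban1982Higgs2, (2.28) p.563] -/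
abbrev inSet (N : ℕ) (Λ : Finset (HiggsLattice.Site P k)) : HiggsLattice.Site P k × Ix N → Prop := fun s => s.1 ∈ Λ

/-- Decidability of `inSet`. [cite: Balaban1982Higgs2, (2.28) p.563] -/
instance instDecidablePredInSet (Λ : Finset (HiggsLattice.Site P k)) : DecidablePred (inSet (P := P) N Λ) :=
  fun s => inferInstanceAs (Decidable (s.1 ∈ Λ))

/-- **The cut `Λφ` in coordinates is p15's gluing `(φ↾_Λ on Λ, 0 on Λᶜ)`**: `fieldCoord(Λφ) = glue (fieldCoord φ)↾_Λ 0`.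
[cite: Balaban1982Higgs2, (2.28) p.563] -/
theorem fieldCoord_cutTo (Λ : Finset (HiggsLattice.Site P k)) (φ : ScalarField P k N) :
    fieldCoord (E N) (HiggsLattice.Site P k) (cutTo Λ φ)
      = glue (inSet N Λ) (resIn (inSet N Λ) (fieldCoord (E N) (HiggsLattice.Site P k) φ)) 0 := by
  funext s
  rw [fieldCoord_apply]
  by_cases hs : s.1 ∈ Λ
  · have hg : glue (inSet N Λ) (resIn (inSet N Λ) (fieldCoord (E N) (HiggsLattice.Site P k) φ)) 0 s
        = fieldCoord (E N) (HiggsLattice.Site P k) φ s := by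
      simp [glue, resIn, hs]
    rw [hg, fieldCoord_apply, cutTo_of_mem Λ φ hs]
  · have hg : glue (inSet N Λ) (resIn (inSet N Λ) (fieldCoord (E N) (HiggsLattice.Site P k) φ)) 0 s = 0 := by
      simp [glue, hs]
    rw [hg, cutTo_of_not_mem Λ φ hs, map_zero]
    rfl

/-- `fieldCoord(Λᶜφ) = glue 0 (fieldCoord φ)↾_{Λᶜ}`. [cite: Balaban1982Higgs2, (2.28) p.563] -/
theorem fieldCoord_cutTo_compl (Λ : Finset (HiggsLattice.Site P k)) (φ : ScalarField P k N) :
    fieldCoord (E N) (HiggsLattice.Site P k) (cutTo Λᶜ φ)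
      = glue (inSet N Λ) 0 (resOut (inSet N Λ) (fieldCoord (E N) (HiggsLattice.Site P k) φ)) := by
  funext s
  rw [fieldCoord_apply]
  by_cases hs : s.1 ∈ Λ
  · have hg : glue (inSet N Λ) 0 (resOut (inSet N Λ) (fieldCoord (E N) (HiggsLattice.Site P k) φ)) s = 0 := by
      simp [glue, hs]
    have hs' : s.1 ∉ Λᶜ := fun h => (Finset.mem_compl.mp h) hs
    rw [hg, cutTo_of_not_mem Λᶜ φ hs', map_zero]
    rfl
  · have hg : glue (inSet N Λ) 0 (resOut (inSet N Λ) (fieldCoord (E N) (HiggsLattice.Site P k) φ)) s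
        = fieldCoord (E N) (HiggsLattice.Site P k) φ s := by
      simp [glue, resOut, hs]
    rw [hg, fieldCoord_apply, cutTo_of_mem Λᶜ φ (Finset.mem_compl.mpr hs)]

/-- **The configuration `φ′ : Λ → R^N` extended by zero**, as a field on `T^{(k)}`: the inverse coordinates of
`glue φ′ 0` (the argument `glue p x 0` of p15's `model.condInt`). [cite: Balaban1982Higgs2, (2.28) p.563] -/
noncomputable def fieldOfCrd (Λ : Finset (HiggsLattice.Site P k)) (x : In (inSet (P := P) N Λ) → ℝ) : ScalarField P k N :=
  (fieldCoord (E N) (HiggsLattice.Site P k)).symm (glue (inSet N Λ) x 0)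

/-- `fieldCoord (fieldOfCrd Λ x) = glue x 0`. [cite: Balaban1982Higgs2, (2.28) p.563] -/
theorem fieldCoord_fieldOfCrd (Λ : Finset (HiggsLattice.Site P k)) (x : In (inSet (P := P) N Λ) → ℝ) :
    fieldCoord (E N) (HiggsLattice.Site P k) (fieldOfCrd Λ x) = glue (inSet N Λ) x 0 :=
  LinearEquiv.apply_symm_apply _ _

/-- `fieldOfCrd Λ x` is supported in `Λ`: `Λ(fieldOfCrd Λ x) = fieldOfCrd Λ x`. [cite: Balaban1982Higgs2, (2.28) p.563] -/
theorem cutTo_fieldOfCrd (Λ : Finset (HiggsLattice.Site P k)) (x : In (inSet (P := P) N Λ) → ℝ) :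
    cutTo Λ (fieldOfCrd Λ x) = fieldOfCrd Λ x := by
  apply (fieldCoord (E N) (HiggsLattice.Site P k)).injective
  rw [fieldCoord_cutTo, fieldCoord_fieldOfCrd, B2Eq228Conditioning.resIn_glue]

/-- `(fieldCoord (fieldOfCrd Λ x))↾_Λ = x`. [cite: Balaban1982Higgs2, (2.28) p.563] -/
theorem resIn_fieldCoord_fieldOfCrd (Λ : Finset (HiggsLattice.Site P k)) (x : In (inSet (P := P) N Λ) → ℝ) :
    resIn (inSet N Λ) (fieldCoord (E N) (HiggsLattice.Site P k) (fieldOfCrd Λ x)) = x := by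
  rw [fieldCoord_fieldOfCrd, B2Eq228Conditioning.resIn_glue]

/-- The zero extension of the coordinates of a field is its cut: `fieldOfCrd Λ (fieldCoord φ)↾_Λ = Λφ`.
[cite: Balaban1982Higgs2, (2.28) p.563] -/
theorem fieldOfCrd_resIn (Λ : Finset (HiggsLattice.Site P k)) (φ : ScalarField P k N) :
    fieldOfCrd Λ (resIn (inSet N Λ) (fieldCoord (E N) (HiggsLattice.Site P k) φ)) = cutTo Λ φ := by
  apply (fieldCoord (E N) (HiggsLattice.Site P k)).injective
  rw [fieldCoord_fieldOfCrd, fieldCoord_cutTo]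

/-- `mat f` acts on ALL coordinate vectors as `f` (p35's `mat_mulVec` through the inverse coordinates).
[cite: Balaban1982Higgs1, (1.5) p.604] -/
theorem mat_mulVec_crd {i j : ℕ} (f : ScalarField P i N →ₗ[ℝ] ScalarField P j N) (u : HiggsLattice.Site P i × Ix N → ℝ) :
    mat f *ᵥ u = fieldCoord (E N) (HiggsLattice.Site P j) (f ((fieldCoord (E N) (HiggsLattice.Site P i)).symm u)) := by
  have h := mat_mulVec f ((fieldCoord (E N) (HiggsLattice.Site P i)).symm u)
  rwa [LinearEquiv.apply_symm_apply] at h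

variable (C : ChargeData N) (Ω : Finset (HiggsLattice.Site P 0)) (A : HiggsLattice.VecField P 0) (msq a : ℝ)

/-- **The matrix `A` of II (2.28) for the scalar field at level `k`**: the coordinate matrix of the *"main quadratic form
in the field φ′"*, `⟨φ′, (a(L^{k+1}ε)^{−2}P(A) + Δ^{(k),L^kε}(Ω,A))φ′⟩_{(1.5)}` — p35's `B1Eq230FluctCov.mat` of `precOpA`
times the weight `(L^kε)^d` of the scalar product (1.5). [cite: Balaban1982Higgs2, (2.28) p.563] -/
noncomputable def formMat (k : ℕ) : Matrix (HiggsLattice.Site P k × Ix N) (HiggsLattice.Site P k × Ix N) ℝ :=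
  (P.mesh k ^ P.d) • mat (precOpA C Ω A msq a k)

/-- `formMat` represents the quadratic form of (2.30) for (1.5): `u·(formMat)v = ⟨φ, (a(L^{k+1}ε)^{−2}P(A) + Δ^{(k)}(Ω,A))ψ⟩`
for `u = fieldCoord φ`, `v = fieldCoord ψ`. [cite: Balaban1982Higgs2, (2.28) p.563] -/
theorem dotProduct_formMat_mulVec (k : ℕ) (u v : HiggsLattice.Site P k × Ix N → ℝ) :
    u ⬝ᵥ (formMat C Ω A msq a k *ᵥ v)
      = siteInner ((fieldCoord (E N) (HiggsLattice.Site P k)).symm u)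
          (precOpA C Ω A msq a k ((fieldCoord (E N) (HiggsLattice.Site P k)).symm v)) := by
  rw [formMat, Matrix.smul_mulVec, dotProduct_smul, mat_mulVec_crd, siteInner_eq_dotProduct,
    LinearEquiv.apply_symm_apply, smul_eq_mul]

/-- The same on coordinates of fields: `(fieldCoord φ)·(formMat)(fieldCoord ψ) = ⟨φ, (…)ψ⟩_{(1.5)}`.
[cite: Balaban1982Higgs2, (2.28) p.563] -/
theorem fieldCoord_dotProduct_formMat (k : ℕ) (φ ψ : ScalarField P k N) :
    fieldCoord (E N) (HiggsLattice.Site P k) φ ⬝ᵥ (formMat C Ω A msq a k *ᵥ fieldCoord (E N) (HiggsLattice.Site P k) ψ)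
      = siteInner φ (precOpA C Ω A msq a k ψ) := by
  rw [dotProduct_formMat_mulVec, LinearEquiv.symm_apply_apply, LinearEquiv.symm_apply_apply]

/-- **p15's Gaussian weight `e^{−½u·Au}` at `A = formMat` IS the scalar Gaussian density `exp(−½⟨φ′,(aL^{−2}P(A)+Δ^{(k)}(Ω,A))φ′⟩)`
of II (2.45)** (in coordinates). [cite: Balaban1982Higgs2, (2.45) p.567] -/
theorem weight_formMat (k : ℕ) (φ : ScalarField P k N) :
    weight (formMat C Ω A msq a k) (fieldCoord (E N) (HiggsLattice.Site P k) φ)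
      = Real.exp (-(1 / 2 : ℝ) * siteInner φ (precOpA C Ω A msq a k φ)) := by
  rw [weight, fieldCoord_dotProduct_formMat]

/-- **p15's `gaussInt` over `S → ℝ` IS the field integral**: `∫du e^{−½u·(formMat)u} h(u) = ∫dφ′ e^{−½⟨φ′,(…)φ′⟩} h(fieldCoord φ′)`
(p34's measure-preserving coordinates `B1Eq221Coordinates.integral_comp_fieldCoord`; `dφ′` = Lebesgue measure on the
scalar fields of `T^{(k)}`, p. 605). [cite: Balaban1982Higgs2, (2.28) p.563] -/
theorem integral_weight_eq_field (k : ℕ) (h : (HiggsLattice.Site P k × Ix N → ℝ) → ℝ) :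
    ∫ u, weight (formMat C Ω A msq a k) u * h u
      = ∫ φ : ScalarField P k N, Real.exp (-(1 / 2 : ℝ) * siteInner φ (precOpA C Ω A msq a k φ))
          * h (fieldCoord (E N) (HiggsLattice.Site P k) φ) := by
  rw [integral_comp_fieldCoord (E N) (HiggsLattice.Site P k)]
  refine integral_congr_ae (Filter.Eventually.of_forall fun u => ?_)
  simp only [LinearEquiv.apply_symm_apply]
  rw [← weight_formMat, LinearEquiv.apply_symm_apply]

end Letters

/-! ## §2 `formMat` is symmetric positive definite; II (2.28) for the model -/

section PosDef

variable {k : ℕ} (C : ChargeData N) (Ω : Finset (HiggsLattice.Site P 0)) (A : HiggsLattice.VecField P 0) (msq a : ℝ)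

/-- The bilinear form of `formMat` is symmetric (the operator of (2.30) is symmetric for (1.5),
`B1Eq230FluctCovPos.siteInner_precOpA_comm`). [cite: Balaban1982Higgs2, (2.28) p.563] -/
theorem dotProduct_formMat_mulVec_comm (k : ℕ) (u v : HiggsLattice.Site P k × Ix N → ℝ) :
    u ⬝ᵥ (formMat C Ω A msq a k *ᵥ v) = v ⬝ᵥ (formMat C Ω A msq a k *ᵥ u) := by
  rw [dotProduct_formMat_mulVec, dotProduct_formMat_mulVec, siteInner_precOpA_comm]

/-- **`formMat` is symmetric** (a symmetric bilinear form has a symmetric matrix; the weight of (1.5) is uniform).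
[cite: Balaban1982Higgs2, (2.28) p.563] -/
theorem formMat_isSymm (k : ℕ) : (formMat C Ω A msq a k).IsSymm := by
  unfold Matrix.IsSymm
  refine Matrix.ext_iff_mulVec.mpr fun v => funext fun i => ?_
  rw [Matrix.mulVec_transpose, ← single_one_dotProduct i (v ᵥ* formMat C Ω A msq a k), dotProduct_comm,
    ← Matrix.dotProduct_mulVec, dotProduct_formMat_mulVec_comm, single_one_dotProduct]

/-- **`formMat` is POSITIVE DEFINITE** — II p. 563 *"let A be a positive operator"* HOLDS for the concrete scalar quadratic
form at every step (m² > 0, a > 0, L > 1, k ≤ K; every `A`, `Ω`, `C`), by file 1's `siteInner_precOpA_pos`.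
[cite: Balaban1982Higgs2, (2.28) p.563] -/
theorem formMat_posDef {msq a : ℝ} (hmsq : 0 < msq) (ha : 0 < a) (hL : 1 < (P.L : ℝ)) (hk : k ≤ P.K) :
    (formMat C Ω A msq a k).PosDef := by
  refine Matrix.PosDef.of_dotProduct_mulVec_pos ?_ fun x hx => ?_
  · rw [Matrix.IsHermitian, Matrix.conjTranspose_eq_transpose_of_trivial]
    exact formMat_isSymm C Ω A msq a k
  · rw [star_trivial, dotProduct_formMat_mulVec]
    have hφ : (fieldCoord (E N) (HiggsLattice.Site P k)).symm x ≠ 0 := by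
      intro h0
      apply hx
      rw [← (fieldCoord (E N) (HiggsLattice.Site P k)).apply_symm_apply x, h0, map_zero]
    exact siteInner_precOpA_pos C Ω A hmsq ha hL hk hφ

/-- The block `A_Λ` is positive definite (Mathlib: principal submatrices of positive definite matrices).
[cite: Balaban1982Higgs2, (2.28) p.563] -/
theorem blkIn_formMat_posDef {msq a : ℝ} (hmsq : 0 < msq) (ha : 0 < a) (hL : 1 < (P.L : ℝ)) (hk : k ≤ P.K)
    (Λ : Finset (HiggsLattice.Site P k)) : (blkIn (inSet N Λ) (formMat C Ω A msq a k)).PosDef :=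
  (formMat_posDef C Ω A hmsq ha hL hk).submatrix Subtype.val_injective

/-- **II (2.28) FOR THE CONCRETE MODEL**: p15's `display228_of_bounded` with `A := formMat` (its positivity hypothesis
DISCHARGED), any conditioning set `Λ ⊂ T^{(k)}`, any source `f`, bounded measurable `F(φ↾_Λ)`, `G(φ↾_{Λᶜ})` — the
print's case *"F = χ′exp(V⁽⁰⁾(Λ₇)), and the function G is the product of the characteristic functions … and the
remaining exponential functions"*. PROVED. [cite: Balaban1982Higgs2, (2.28) p.563] -/
theorem display228_model {msq a : ℝ} (hmsq : 0 < msq) (ha : 0 < a) (hL : 1 < (P.L : ℝ)) (hk : k ≤ P.K)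
    (Λ : Finset (HiggsLattice.Site P k)) (f : HiggsLattice.Site P k × Ix N → ℝ)
    {F₀ : (In (inSet (P := P) N Λ) → ℝ) → ℝ} {G₀ : (Out (inSet (P := P) N Λ) → ℝ) → ℝ}
    (hF : Measurable F₀) (hG : Measurable G₀) {CF CG : ℝ} (hFb : ∀ x, |F₀ x| ≤ CF) (hGb : ∀ y, |G₀ y| ≤ CG) :
    B2.Display228 (model (inSet N Λ) (formMat C Ω A msq a k) f F₀ G₀) :=
  B2Eq228Conditioning.display228_of_bounded (inSet N Λ) (formMat C Ω A msq a k) f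
    (formMat_posDef C Ω A hmsq ha hL hk) hF hG hFb hGb

end PosDef

/-! ## §3 `dμ_{C^{(k)}_Λ(Ω,A)}`: the conditional Gaussian measure; its covariance matrix is the block of (2.32) -/

section Measure

variable {k : ℕ} (C : ChargeData N) (Ω : Finset (HiggsLattice.Site P 0)) (A : HiggsLattice.VecField P 0) (msq a : ℝ)

/-- **`dμ_{C^{(k)}_Λ(Ω,A)}(φ′)`** — the *"probabilistic Gaussian measure with the covariance A_Λ⁻¹"* of II (2.28) for
the concrete scalar quadratic form at level `k`, i.e. with the covariance `C^{(k)}_Λ(Ω,A)` of I (2.32): p15's `gaussProb`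
of the block `(formMat)_Λ`, a measure on the configurations `φ′ : Λ → R^N` in coordinates (`In (inSet Λ) → ℝ`; the field
is `fieldOfCrd Λ φ′`).  It is the `condInt` of `model (inSet Λ) formMat …`. [cite: Balaban1982Higgs1, (2.32) p.611] -/
noncomputable def condGauss (k : ℕ) (Λ : Finset (HiggsLattice.Site P k)) : Measure (In (inSet (P := P) N Λ) → ℝ) :=
  gaussProb (blkIn (inSet N Λ) (formMat C Ω A msq a k))

/-- Unfolding of `condGauss`. [cite: Balaban1982Higgs1, (2.32) p.611] -/
theorem condGauss_eq (Λ : Finset (HiggsLattice.Site P k)) :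
    condGauss C Ω A msq a k Λ = gaussProb (blkIn (inSet N Λ) (formMat C Ω A msq a k)) := rfl

/-- **`dμ_{C^{(k)}_Λ(Ω,A)}` is a probability measure** (m² > 0, a > 0, L > 1, k ≤ K; every `A`, `Ω`, `C`, `Λ`). PROVED.
[cite: Balaban1982Higgs1, (2.32) p.611] -/
theorem isProbabilityMeasure_condGauss {msq a : ℝ} (hmsq : 0 < msq) (ha : 0 < a) (hL : 1 < (P.L : ℝ)) (hk : k ≤ P.K)
    (Λ : Finset (HiggsLattice.Site P k)) : IsProbabilityMeasure (condGauss C Ω A msq a k Λ) :=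
  B2Eq228Conditioning.isProbabilityMeasure_gaussProb (blkIn_formMat_posDef C Ω A hmsq ha hL hk Λ)

/-- `blkIn` commutes with scalars (definitional). [cite: Balaban1982Higgs2, (2.28) p.563] -/
theorem blkIn_smul {ι : Type} [Fintype ι] (p : ι → Prop) [DecidablePred p] (w : ℝ) (M : Matrix ι ι ℝ) :
    blkIn p (w • M) = w • blkIn p M := rfl

/-- **The block `A_Λ` of a coordinate matrix acts through the zero extension**: `(mat M)_Λ·x = (fieldCoord (M (fieldOfCrd Λ x)))↾_Λ`.
[cite: Balaban1982Higgs2, (2.28) p.563] -/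
theorem blkIn_mat_mulVec (Λ : Finset (HiggsLattice.Site P k)) (M : Module.End ℝ (ScalarField P k N))
    (x : In (inSet (P := P) N Λ) → ℝ) :
    blkIn (inSet N Λ) (mat M) *ᵥ x
      = resIn (inSet N Λ) (fieldCoord (E N) (HiggsLattice.Site P k) (M (fieldOfCrd Λ x))) := by
  funext i
  have h := B2Eq228Conditioning.mulVec_glue_in (inSet N Λ) (mat M) x 0 i
  rw [Matrix.mulVec_zero, Pi.zero_apply, add_zero] at h
  rw [← h, mat_mulVec_crd]
  rfl

/-- **Restriction does not change the `Λ`-block**: `(mat M↾_Λ)_Λ = (mat M)_Λ` (I p. 611 `A↾_Λφ = ΛAΛφ` read in coordinates).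
[cite: Balaban1982Higgs1, (2.32) p.611] -/
theorem blkIn_mat_restrictOp (Λ : Finset (HiggsLattice.Site P k)) (M : Module.End ℝ (ScalarField P k N)) :
    blkIn (inSet N Λ) (mat (restrictOp Λ M)) = blkIn (inSet N Λ) (mat M) := by
  refine Matrix.ext_iff_mulVec.mpr fun x => ?_
  rw [blkIn_mat_mulVec, blkIn_mat_mulVec, restrictOp_apply, cutTo_fieldOfCrd, fieldCoord_cutTo,
    B2Eq228Conditioning.resIn_glue]

/-- **`(mat (M↾_Λ)^{−1})_Λ · (mat M↾_Λ)_Λ = 1`**: in the `Λ`-block, file 2's `restrictInv` inverts the restricted operator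
(whenever the padded operator is a unit). [cite: Balaban1982Higgs1, (2.32) p.611] -/
theorem blkIn_mat_restrictInv_mul (Λ : Finset (HiggsLattice.Site P k)) (M : Module.End ℝ (ScalarField P k N))
    (hU : IsUnit (padOp Λ M)) :
    blkIn (inSet N Λ) (mat (restrictInv Λ M)) * blkIn (inSet N Λ) (mat (restrictOp Λ M)) = 1 := by
  refine Matrix.ext_iff_mulVec.mpr fun x => ?_
  rw [← Matrix.mulVec_mulVec, Matrix.one_mulVec, blkIn_mat_mulVec, blkIn_mat_mulVec, fieldOfCrd_resIn,
    restrictInv_cutTo, restrictInv_restrictOp_apply Λ M hU, cutTo_fieldOfCrd, resIn_fieldCoord_fieldOfCrd]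

/-- **The covariance matrix of `dμ` IS the block of (2.32)**: `(A_Λ)⁻¹ = (L^kε)^{−d} · (mat C^{(k)}_Λ(Ω,A))_Λ` for
`A = formMat` (m² > 0, a > 0, L > 1, k ≤ K). PROVED. [cite: Balaban1982Higgs1, (2.32) p.611] -/
theorem inv_blkIn_formMat {msq a : ℝ} (hmsq : 0 < msq) (ha : 0 < a) (hL : 1 < (P.L : ℝ)) (hk : k ≤ P.K)
    (Λ : Finset (HiggsLattice.Site P k)) :
    (blkIn (inSet N Λ) (formMat C Ω A msq a k))⁻¹
      = (P.mesh k ^ P.d)⁻¹ • blkIn (inSet N Λ) (mat (condCov232 C Ω A msq a k Λ)) := by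
  have hw : (P.mesh k ^ P.d) ≠ 0 := (pow_pos (P.mesh_pos k) _).ne'
  have hU := isUnit_padOp_precOpA C Ω A hmsq ha hL hk Λ
  refine Matrix.inv_eq_left_inv ?_
  rw [formMat, blkIn_smul, ← blkIn_mat_restrictOp Λ (precOpA C Ω A msq a k : Module.End ℝ (ScalarField P k N)),
    smul_mul_assoc, mul_smul_comm, smul_smul, inv_mul_cancel₀ hw, one_smul, condCov232]
  exact blkIn_mat_restrictInv_mul Λ _ hU

end Measure

/-! ## §4 The covariance identity: the moment generating function of `dμ_{C^{(k)}_Λ(Ω,A)}` -/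

section MGF

variable {k : ℕ} (C : ChargeData N) (Ω : Finset (HiggsLattice.Site P 0)) (A : HiggsLattice.VecField P 0) (msq a : ℝ)

/-- **MGF in coordinates**: `∫ e^{−j·φ′} dμ_{A_Λ⁻¹}(φ′) = e^{½ j·A_Λ⁻¹j}` for `A = formMat` (p15's linear shift
`integral_tilt` and the normalisation). [cite: Balaban1982Higgs2, (2.28) p.563] -/
theorem integral_exp_neg_dotProduct_condGauss {msq a : ℝ} (hmsq : 0 < msq) (ha : 0 < a) (hL : 1 < (P.L : ℝ))
    (hk : k ≤ P.K) (Λ : Finset (HiggsLattice.Site P k)) (j : In (inSet (P := P) N Λ) → ℝ) :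
    ∫ x, Real.exp (-(j ⬝ᵥ x)) ∂(condGauss C Ω A msq a k Λ)
      = Real.exp (1 / 2 * (j ⬝ᵥ ((blkIn (inSet N Λ) (formMat C Ω A msq a k))⁻¹ *ᵥ j))) := by
  set B := blkIn (inSet N Λ) (formMat C Ω A msq a k) with hB
  have hBpd : B.PosDef := blkIn_formMat_posDef C Ω A hmsq ha hL hk Λ
  have hBs : B.IsSymm := by
    have h := hBpd.isHermitian.eq
    rwa [Matrix.conjTranspose_eq_transpose_of_trivial] at h
  have hdet : IsUnit B.det := isUnit_iff_ne_zero.2 hBpd.det_pos.ne'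
  have hN : gaussNorm B ≠ 0 := (B2Eq228Conditioning.gaussNorm_pos hBpd).ne'
  rw [condGauss_eq, ← hB, B2Eq228Conditioning.integral_gaussProb_eq]
  have htilt := B2Eq228Conditioning.integral_tilt B hBs hdet j (fun _ => (1 : ℝ))
  simp only [mul_one, B13GaugeDevices.gaussInt_one_eq_gaussNorm] at htilt
  have hint : ∫ x, gaussWeight B x * Real.exp (-(j ⬝ᵥ x))
      = ∫ x, Real.exp (-(j ⬝ᵥ x) - 1 / 2 * (x ⬝ᵥ (B *ᵥ x))) := by
    refine integral_congr_ae (Filter.Eventually.of_forall fun x => ?_)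
    show gaussWeight B x * Real.exp (-(j ⬝ᵥ x)) = Real.exp (-(j ⬝ᵥ x) - 1 / 2 * (x ⬝ᵥ (B *ᵥ x)))
    rw [gaussWeight, ← Real.exp_add]
    congr 1
    ring
  rw [hint, htilt, mul_comm (Real.exp _) (gaussNorm B), ← mul_assoc, inv_mul_cancel₀ hN, one_mul]

/-- `⟨g, fieldOfCrd Λ x⟩_{(1.5)} = (L^kε)^d · (fieldCoord g)↾_Λ · x` (the pairing of a field with a zero-extended configuration).
[cite: Balaban1982Higgs1, (1.5) p.604] -/
theorem siteInner_fieldOfCrd (Λ : Finset (HiggsLattice.Site P k)) (g : ScalarField P k N)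
    (x : In (inSet (P := P) N Λ) → ℝ) :
    siteInner g (fieldOfCrd Λ x)
      = P.mesh k ^ P.d * (resIn (inSet N Λ) (fieldCoord (E N) (HiggsLattice.Site P k) g) ⬝ᵥ x) := by
  rw [siteInner_eq_dotProduct, fieldCoord_fieldOfCrd, dotProduct, B2Eq228Conditioning.linForm_glue, dotProduct_zero,
    add_zero]

/-- `⟨g, C^{(k)}_Λ(Ω,A)g⟩_{(1.5)} = (L^kε)^d · (fieldCoord g)↾_Λ · (mat C^{(k)}_Λ)_Λ (fieldCoord g)↾_Λ` (`C^{(k)}_Λ` reads only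
`Λg` and is supported in `Λ`). [cite: Balaban1982Higgs1, (2.32) p.611] -/
theorem siteInner_condCov232_eq_blkIn (Λ : Finset (HiggsLattice.Site P k)) (g : ScalarField P k N) :
    siteInner g (condCov232 C Ω A msq a k Λ g)
      = P.mesh k ^ P.d * (resIn (inSet N Λ) (fieldCoord (E N) (HiggsLattice.Site P k) g)
          ⬝ᵥ (blkIn (inSet N Λ) (mat (condCov232 C Ω A msq a k Λ))
              *ᵥ resIn (inSet N Λ) (fieldCoord (E N) (HiggsLattice.Site P k) g))) := by
  rw [blkIn_mat_mulVec, fieldOfCrd_resIn, condCov232_cutTo]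
  have hsupp : condCov232 C Ω A msq a k Λ g = cutTo Λ (condCov232 C Ω A msq a k Λ g) := by
    funext y
    by_cases hy : y ∈ Λ
    · rw [cutTo_of_mem Λ _ hy]
    · rw [cutTo_of_not_mem Λ _ hy, condCov232_apply_of_not_mem C Ω A msq a k Λ g hy]
  conv_lhs => rw [hsupp, ← fieldOfCrd_resIn]
  rw [siteInner_fieldOfCrd]

/-- **THE COVARIANCE IDENTITY — `dμ_{C^{(k)}_Λ(Ω,A)}` is the centred Gaussian measure with covariance `C^{(k)}_Λ(Ω,A)` for the
scalar product (1.5)**: `∫ e^{⟨g,φ′⟩} dμ_{C^{(k)}_Λ(Ω,A)}(φ′) = e^{½⟨g, C^{(k)}_Λ(Ω,A)g⟩}` for every field `g` on `T^{(k)}`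
(m² > 0, a > 0, L > 1, k ≤ K; every `A`, `Ω`, `C`, `Λ`). PROVED. [cite: Balaban1982Higgs1, (2.32) p.611] -/
theorem integral_exp_siteInner_condGauss {msq a : ℝ} (hmsq : 0 < msq) (ha : 0 < a) (hL : 1 < (P.L : ℝ)) (hk : k ≤ P.K)
    (Λ : Finset (HiggsLattice.Site P k)) (g : ScalarField P k N) :
    ∫ x, Real.exp (siteInner g (fieldOfCrd Λ x)) ∂(condGauss C Ω A msq a k Λ)
      = Real.exp (1 / 2 * siteInner g (condCov232 C Ω A msq a k Λ g)) := by
  set w : ℝ := P.mesh k ^ P.d with hw_def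
  have hw : w ≠ 0 := (pow_pos (P.mesh_pos k) _).ne'
  set r := resIn (inSet N Λ) (fieldCoord (E N) (HiggsLattice.Site P k) g) with hr
  have h1 : ∀ x : In (inSet (P := P) N Λ) → ℝ, siteInner g (fieldOfCrd Λ x) = -((-(w • r)) ⬝ᵥ x) := fun x => by
    rw [siteInner_fieldOfCrd, ← hw_def, ← hr, neg_dotProduct, neg_neg, smul_dotProduct, smul_eq_mul]
  simp_rw [h1]
  rw [integral_exp_neg_dotProduct_condGauss C Ω A hmsq ha hL hk Λ, inv_blkIn_formMat C Ω A hmsq ha hL hk Λ,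
    siteInner_condCov232_eq_blkIn, ← hw_def, ← hr]
  congr 2
  simp only [Matrix.smul_mulVec, Matrix.mulVec_neg, Matrix.mulVec_smul, neg_dotProduct, dotProduct_neg,
    smul_dotProduct, dotProduct_smul, smul_eq_mul, neg_neg, mul_neg]
  field_simp

end MGF

/-! ## §5 The vector-field factor of II (2.46): `N = d`, external field `0` (p. 608) -/

section VectorField

variable {k : ℕ} (msq a : ℝ)

/-- For the VECTOR-field factor of *"the main quadratic form in the fields A′, φ′"* (II (2.45)/(2.46): the conditional
covariance `C^{(k−1),L^{k−1}ε}_{Λ₅}` acting on `A′`), I p. 608 *"N = d and an external vector field A = 0"*: the conditional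
covariance (2.32) at the trivial coupling is the restricted inverse of the typer's vector-field operator
`HiggsFluctMeasure.precOp` (p35's `precOpA_zero_field`), on `ℝ^d`-valued site functions. [cite: Balaban1982Higgs1, (2.32) p.611] -/
theorem condCov232_zero_field (Λ : Finset (HiggsLattice.Site P k)) :
    condCov232 (B3MultiscaleFields.zeroCharge P.d) Finset.univ (0 : HiggsLattice.VecField P 0) msq a k Λ
      = restrictInv Λ (HiggsFluctMeasure.precOp P msq a k : Module.End ℝ (ScalarField P k P.d)) := by
  rw [condCov232, precOpA_zero_field]

/-- … and with no conditioning it is the typer's vector-field covariance `C^{(k),L^kη}` = `HiggsFluctMeasure.fluctCov`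
(whose Gaussian measure is `HiggsFluctMeasure.fluctMeasure`). [cite: Balaban1982Higgs1, (2.30) p.611] -/
theorem condCov232_zero_field_univ :
    condCov232 (B3MultiscaleFields.zeroCharge P.d) Finset.univ (0 : HiggsLattice.VecField P 0) msq a k Finset.univ
      = HiggsFluctMeasure.fluctCov P msq a k := by
  rw [condCov232_univ, fluctCovA_zero_field]

end VectorField

end Literature.MathematicalPhysics.QuantumFieldTheory.Balaban1983to89.HiggsCondGauss228
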